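import Literature.Probability.LatticeModels.Sweep1
import HarnessLib
import Mathlib.Probability.Moments.ComplexMGF
import Mathlib.Probability.Distributions.Gaussian.Real
import Mathlib.Probability.Distributions.Gaussian.Basic
import Mathlib.Probability.Distributions.Gaussian.IsGaussianProcess.Basic
import Mathlib.Analysis.Calculus.BumpFunction.InnerProduct
import Mathlib.Analysis.SpecialFunctions.Pow.Asymptotics

/-!
# High-dimensional triviality of Ising scaling limits: printed estimates and their assembly

Trunk: StatMech (G02); family `crit-ising` (crit-ising.S13). Namespace `Literature.CritIsing`.

This file vendors, as named facts (D-0014), the *printed* quantitative estimates behind the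
statement "every scaling limit of the critical / near-critical nearest-neighbour ferromagnetic
Ising model on `ℤ^d`, `d ≥ 4`, is Gaussian":

* `aizenmanDuminilCopin_mgf_normalizedField_bound` — Aizenman–Duminil-Copin, *Marginal
  triviality of the scaling limits of critical 4D Ising and `φ⁴₄` models*, Ann. of Math. 194
  (2021) 163–235, Proposition 1.4 (arXiv:1912.07973 numbering): for `d = 4`, `β ≤ β_c`,
  `L ≤ ξ(β)` and `f ∈ C_0(ℝ⁴)`, the exponential moments of the block-spin-normalised field
  `T_{f,L} = Σ_L^{-1/2} ∑_x f(x/L) σ_x` satisfy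
  `|⟨exp[z T_{f,L} - z²/2 ⟨T_{f,L}²⟩]⟩ - 1| ≤ C ‖f‖_∞⁴ r_f^{12} z⁴ / (log L)^c`.
* `panis_mgf_normalizedField_bound` — R. Panis, *Triviality of the scaling limits of
  critical Ising and `φ⁴` models with effective dimension at least four*, Ann. Probab. 54
  (2026), arXiv:2309.05797 (theorem numbering of the arXiv version), Theorem 5.5 specialised
  to the nearest-neighbour model on `ℤ^d`, `d ≥ 5` (effective dimension `d_eff = d > 4`,
  `η = 0` by the infrared bound): the same estimate for all `β ≤ β_c`, `L ≥ 1`, with rate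
  `L^{-(d-4)}` and a constant `C (β⁻⁴ ∨ β⁻²)`. (The `d > 4` statement goes back to
  Aizenman, Comm. Math. Phys. 86 (1982) 1 and Fröhlich, Nucl. Phys. B 200 (1982) 281, in
  correlation-function form.)
* `normalizedField_variance_bounds` — the two-sided bound `0 < c_f ≤ ⟨T_{f,L}²⟩_β ≤ C_f`
  uniformly in `β ≤ β_c` and `L` large (ADC 2021, p. 6, display after Prop. 1.4; Panis 2023,
  §1.2.1, footnote 3).

and states the resulting Gaussianity of scaling limits **in the printed regime**,
`isGaussianProcess_of_tendstoInDistribution_smearedSpin_printRegime` (crit-ising.S13,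
corrected form; see the docstring for the discrepancy with
`isGaussianProcess_of_tendstoInDistribution_smearedSpin` of `Sweep1`). The probabilistic
assembly (renormalisation à la Slutsky, convergence of exponential moments under convergence in
law, uniqueness of laws with equal moment generating functions, linearity) deriving the latter
from the three named facts is proved in Part II of this file
(`isGaussianProcess_of_tendstoInDistribution_smearedSpin_printRegime_of_bounds`).

## Local glue

* `latticeBox d L = [-L, L]^d ∩ ℤ^d` (real `L`), `blockSpinVariance μ L = Σ_L =
  E_μ[(∑_{x ∈ Λ_L} σ_x)²]`, `normalizedField μ L f = T_{f,L} = Σ_L^{-1/2} ∑_x f(x/L) σ_x`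
  (ADC 2021, §1.2, p. 4; Panis 2023, §1.2.1, p. 6); `normalizedField_eq_smearedSpin` relates
  it to the field `smearedSpin ρ δ f` of `Sweep1` (`δ = 1/L`, `ρ = Σ_L^{-1/2} L^d`).

## Design choices

* The printed `⟨·⟩_β` is "the" infinite-volume state; the facts are stated for every DLR state
  `μ ∈ 𝒢(β, 0) = isingGibbsMeasures d β 0`, a singleton for `0 ≤ β ≤ β_c`, `d ≥ 2`
  (crit-ising.S25 `hasUniqueGibbsMeasure_of_lt_criticalBeta`; Aizenman–Duminil-Copin–Sidoravicius
  2015 at `β_c`, `hasUniqueGibbsMeasure_criticalBeta_of_lroTildeSq`).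
* `L ≤ ξ(β)`: `ξ(β)` is the correlation length of ADC §1.3 (p. 5); we write the condition as
  `L · ξ(β)⁻¹ ≤ 1` with `ξ⁻¹ = invCorrLength (twoPointPlus 4 β)` (the `liminf` form of the
  inverse correlation length of the prelude `CorrelationDecay`, equal to the limit whenever it
  exists), for `0 < β` only (at `β = 0` the prelude value is junk), and separately allow
  `β = β_c`, where `ξ(β_c) = +∞` (ADC p. 5) and every `L` qualifies.
* Numbering follows the held arXiv texts (arXiv:1912.07973 for ADC, where Prop. 1.4 is the
  exponential-moment estimate and Thm 1.3 the improved tree diagram bound; arXiv:2309.05797 for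
  Panis). `references.bib` records a corrigendum to ADC (Ann. of Math. 199 (2024) 479), not held
  in the literature store when this file was written (acquisition requested); the statements
  below are those of the arXiv version.
* Test functions are, as in print, continuous functions vanishing outside a cube `[-r, r]^d`;
  following the printed proofs (ADC p. 26 "recall that by definition `r ≥ 1`"; Panis, Thm 1.2,
  `r_f := (…) ∨ 1`) we take `r ≥ 1`. `‖f‖_∞` is `⨆ x, |f x|`.
* The estimates are recorded, as printed, for the exponential moments `⟨exp(z T_{f,L})⟩` with
  `z ∈ ℝ` (Panis, Thm 5.5: "`z ∈ ℝ`"; ADC Prop. 1.4 leaves `z` real and unquantified); the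
  Gaussianity of limits is then obtained in Part II below through moment generating
  functions (Mathlib's `complexMGF` uniqueness), not characteristic functions.

## Mathlib

Used: `MeasureTheory.TendstoInDistribution`, `ProbabilityTheory.IsGaussianProcess`,
`Fintype.piFinset`, `finsum`, Bochner integrals of real exponentials (no `mgf` API is needed to
*state* the facts). Mathlib has no Ising model / block spin / scaling limit.
-/

noncomputable section

open MeasureTheory ProbabilityTheory Filter Topology TopologicalSpace
open scoped NNReal
open Literature.Probability.LatticeModels Literature.Probability.Percolation

namespace Literature.Probability.LatticeModels

/-! ### Block spins and the normalised field of ADC §1.2 -/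

/-- The lattice box `Λ_L = [-L, L]^d ∩ ℤ^d` for a real `L` (empty for `L < 0`), as a `Finset`
(Aizenman–Duminil-Copin 2021, §1.1–1.2, `Λ_R := [-R, R]^d`; Panis 2023, §1.2.1, p. 6). [cite: AizenmanDuminilCopinAnnals2021, arXiv:1912.07973 §1.2 (p. 4)] -/
def latticeBox (d : ℕ) (L : ℝ) : Finset (Site d) :=
  Fintype.piFinset fun _ : Fin d => Finset.Icc (-⌊L⌋) ⌊L⌋

/-- Membership in `Λ_L`: all coordinates have absolute value `≤ L`
(Aizenman–Duminil-Copin 2021, §1.1–1.2). [cite: AizenmanDuminilCopinAnnals2021, arXiv:1912.07973 §1.2 (p. 4)] -/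
theorem mem_latticeBox {d : ℕ} {L : ℝ} {x : Site d} :
    x ∈ latticeBox d L ↔ ∀ i, |((x i : ℤ) : ℝ)| ≤ L := by
  simp only [latticeBox, Fintype.mem_piFinset, Finset.mem_Icc, abs_le]
  refine forall_congr' fun i => ?_
  rw [← Int.ceil_neg, Int.ceil_le, Int.le_floor]

/-- For `L ≥ 0`, `Λ_L` is the centred cube `box d ⌊L⌋₊` of `ThermodynamicLimit`
(Friedli–Velenik's `B(n)`); the real parametrisation is that of Aizenman–Duminil-Copin
(`Λ_{r L}`, `L ≤ ξ(β)` with `L` real) (Aizenman–Duminil-Copin 2021, §1.1–1.2). [cite: AizenmanDuminilCopinAnnals2021, arXiv:1912.07973 §1.2 (p. 4)] -/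
theorem latticeBox_eq_box {d : ℕ} {L : ℝ} (hL : 0 ≤ L) : latticeBox d L = box d ⌊L⌋₊ := by
  simp only [latticeBox, box, Int.natCast_floor_eq_floor hL]

/-- The block-spin second moment `Σ_L(μ) = E_μ[(∑_{x ∈ Λ_L} σ_x)²]` (the variance of the sum of
the spins over the box of size `L` when `μ` is even) (Aizenman–Duminil-Copin 2021, §1.2, p. 4,
"`Σ_L` denotes the variance of the sum of spins over the box of size `L`"; Panis 2023, §1.2.1). [cite: AizenmanDuminilCopinAnnals2021, arXiv:1912.07973 §1.2 (p. 4)] -/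
def blockSpinVariance {d : ℕ} (μ : Measure (SpinConfig (Site d))) (L : ℝ) : ℝ :=
  ∫ σ, (∑ x ∈ latticeBox d L, spinAt x σ) ^ 2 ∂μ

/-- The block-spin-normalised smeared field of Aizenman–Duminil-Copin,
`T_{f,L}(σ) = Σ_L^{-1/2} ∑_{x ∈ ℤ^d} f(x / L) σ_x` (a `finsum`, finite for compactly supported
`f` and `L ≠ 0`; junk `0` if the support is infinite, and `Σ_L^{-1/2}` is junk `0` if
`Σ_L(μ) = 0`) (Aizenman–Duminil-Copin 2021, §1.2, p. 4, definition of `T_{f,L}`; Panis 2023,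
§1.2.1, p. 6). [cite: AizenmanDuminilCopinAnnals2021, arXiv:1912.07973 §1.2 (p. 4)] -/
def normalizedField {d : ℕ} (μ : Measure (SpinConfig (Site d))) (L : ℝ)
    (f : EuclideanSpace ℝ (Fin d) → ℝ) (σ : SpinConfig (Site d)) : ℝ :=
  (Real.sqrt (blockSpinVariance μ L))⁻¹ * ∑ᶠ x : Site d, f (L⁻¹ • siteVec x) * spinAt x σ

/-- `T_{f,L}` is the rescaled field `Φ_δ(f) = ρ δ^d ∑_x f(δ x) σ_x` of `Sweep1` at mesh
`δ = 1/L` with renormalisation `ρ = Σ_L^{-1/2} L^d` (Aizenman–Duminil-Copin 2021, §1.2, p. 4).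
[cite: AizenmanDuminilCopinAnnals2021, arXiv:1912.07973 §1.2 (p. 4)] -/
theorem normalizedField_eq_smearedSpin {d : ℕ} (μ : Measure (SpinConfig (Site d))) {L : ℝ}
    (hL : L ≠ 0) (f : EuclideanSpace ℝ (Fin d) → ℝ) (σ : SpinConfig (Site d)) :
    normalizedField μ L f σ =
      smearedSpin ((Real.sqrt (blockSpinVariance μ L))⁻¹ * L ^ d) L⁻¹ f σ := by
  simp only [normalizedField, smearedSpin, inv_pow, mul_assoc]
  rw [← mul_assoc (L ^ d), mul_inv_cancel₀ (pow_ne_zero d hL), one_mul]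

/-! ### The printed estimates (named facts) -/

/-- **Aizenman–Duminil-Copin 2021, Proposition 1.4** (arXiv:1912.07973 numbering; the estimate
behind Thm 1.2 there, "Gaussianity of `Φ⁴₄`", which includes the critical Ising model as a hard
limit). There exist `c, C > 0` such that for the nearest-neighbour ferromagnetic Ising model on
`ℤ⁴`, every `β ≤ β_c`, every `L ≤ ξ(β)` (`ξ` the correlation length, §1.3; `ξ(β_c) = +∞`), and
every test function `f ∈ C_0(ℝ⁴)` vanishing outside `[-r, r]⁴` (`r ≥ 1`), for all real `z`,
`|⟨exp[z T_{f,L} - z²/2 ⟨T_{f,L}²⟩_β]⟩_β - 1| ≤ C ‖f‖_∞⁴ r^{12} z⁴ / (log L)^c`,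
for every DLR state `μ ∈ 𝒢(β, 0)` (a singleton) and `L > 1`. Here
`T_{f,L} = normalizedField μ L f`. Print has `r_f` = the diameter of the support of `f`
(`≤ 4r` for `f` vanishing outside `[-r, r]⁴`, so this form follows with `C ↦ 4¹² C`; the proof,
§6.3, p. 26, is written for "`f` which vanishes outside `[-r, r]⁴`", `r ≥ 1`) and `(log L)^c`
presupposes `L > 1`. **Caveat (signed `f`).** This records the statement as printed. The printed
proof (§6.3) smears the inequality of [Aiz82] against `∏ f(xᵢ/L)`, which for a signed `f` bounds
the deviation of `⟨T_{f,L}^{2n}⟩` from its Wick value through the moments of `T_{|f|,L}`; the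
summation over `n` then yields the bound with the prefactor `exp(z²/2 ⟨T_{|f|,L}²⟩)` in place of
the normalisation by `exp(z²/2 ⟨T_{f,L}²⟩)` (the form in which Panis 2023, Cor. 1.8 / Thm 5.5,
restates the estimate). For `f ≥ 0` — the case used on p. 6 to deduce Gaussianity — the two forms
coincide; for signed `f` the printed normalised form is stronger than what the argument gives.
The proof-form statement is vendored as `aizenmanDuminilCopin_mgf_normalizedField_bound_abs` in
`HighDimTrivialityMoments`, where the Gaussianity of scaling limits is re-derived from it.
Named fact (D-0014). [cite: AizenmanDuminilCopinAnnals2021, arXiv:1912.07973 Prop. 1.4 (p. 6), proof §6.3 (p. 26)] -/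
def aizenmanDuminilCopin_mgf_normalizedField_bound : Prop :=
  ∃ c C : ℝ, 0 < c ∧ 0 < C ∧
    ∀ (β L r : ℝ), 0 ≤ β → β ≤ criticalBeta 4 →
      (β = criticalBeta 4 ∨ (0 < β ∧ L * invCorrLength (twoPointPlus 4 β) ≤ 1)) →
      1 < L → 1 ≤ r →
    ∀ μ ∈ isingGibbsMeasures 4 β 0,
    ∀ f : EuclideanSpace ℝ (Fin 4) → ℝ, Continuous f → (∀ x, f x ≠ 0 → ∀ i, |x i| ≤ r) →
    ∀ z : ℝ,
      |(∫ σ, Real.exp (z * normalizedField μ L f σ -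
            z ^ 2 / 2 * ∫ σ', normalizedField μ L f σ' ^ 2 ∂μ) ∂μ) - 1|
        ≤ C * (⨆ x, |f x|) ^ 4 * r ^ 12 * z ^ 4 / Real.log L ^ c

/-- **Panis 2023, Theorem 5.5** for the nearest-neighbour ferromagnetic Ising model on `ℤ^d`,
`d ≥ 5` (the model satisfies (A1)–(A5), §1.2.1, and the standing effective-dimension assumption
of §5 (p. 21) with `η = 0`, `d + 2η > 4`, by the infrared bound `⟨σ₀σ_x⟩_{β_c} ≤ C/|x|^{d-2}`
of Fröhlich–Simon–Spencer / Fröhlich–Israel–Lieb–Simon recalled in §1.2.1 (p. 6); the `d > 4`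
triviality theorem is originally Aizenman, Comm. Math. Phys. 86 (1982) and Fröhlich, Nucl. Phys.
B 200 (1982)). There exist `C, γ > 0` such that for all `0 < β ≤ β_c`, `L ≥ 1`,
`f ∈ C_0(ℝ^d)` vanishing outside `[-r, r]^d` (`r ≥ 1`) and `z ∈ ℝ`,
`|⟨exp(z T_{f,L})⟩_β - exp(z²/2 ⟨T_{f,L}²⟩_β)| ≤
  exp(z²/2 ⟨T_{|f|,L}²⟩_β) · C (β⁻⁴ ∨ β⁻²) ‖f‖_∞⁴ r^γ z⁴ / L^{d-4}`,
for every DLR state `μ ∈ 𝒢(β, 0)` (a singleton). Print: "for all `β ≤ β_c`" with the constant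
`C (β⁻⁴ ∨ β⁻²)` (infinite at `β = 0`, whence `0 < β` here), and `r_f := (max {|x| : f(x) ≠ 0}) ∨ 1`,
the radius of the support (`≤ d·r` for `f` vanishing outside `[-r, r]^d`, absorbed into `C`).
Named fact (D-0014). [cite: Panis2023Triviality, Thm. 5.5] -/
def panis_mgf_normalizedField_bound : Prop :=
  ∀ {d : ℕ}, 5 ≤ d → ∃ C γ : ℝ, 0 < C ∧ 0 < γ ∧
    ∀ (β L r : ℝ), 0 < β → β ≤ criticalBeta d → 1 ≤ L → 1 ≤ r →
    ∀ μ ∈ isingGibbsMeasures d β 0,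
    ∀ f : EuclideanSpace ℝ (Fin d) → ℝ, Continuous f → (∀ x, f x ≠ 0 → ∀ i, |x i| ≤ r) →
    ∀ z : ℝ,
      |(∫ σ, Real.exp (z * normalizedField μ L f σ) ∂μ) -
          Real.exp (z ^ 2 / 2 * ∫ σ, normalizedField μ L f σ ^ 2 ∂μ)|
        ≤ Real.exp (z ^ 2 / 2 * ∫ σ, normalizedField μ L (fun x => |f x|) σ ^ 2 ∂μ) *
            (C * max (β ^ (-4 : ℤ)) (β ^ (-2 : ℤ)) * (⨆ x, |f x|) ^ 4 * r ^ γ * z ^ 4 /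
              L ^ (d - 4))

/-- **Variance of the normalised field** (Aizenman–Duminil-Copin 2021, p. 6, the display after
Prop. 1.4: "for any non-negative continuous `f ≢ 0` with bounded support,
`C r_f² ‖f‖²_∞ ≥ ⟨T_{f,L}²⟩_β ≥ c_f > 0` uniformly in `β ≤ β_c` and `L`"; Panis 2023, §1.2.1,
footnote 3: "for `f ≠ 0`, `0 < c_f ≤ ⟨T_{f,L,β}²⟩_β ≤ C_f < ∞`"). For the nearest-neighbour
Ising model on `ℤ^d` (`d ≥ 4`) and `f ∈ C_0(ℝ^d)`: (i) `⟨T_{f,L}²⟩_μ ≤ C_f` for all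
`0 ≤ β ≤ β_c`, `L ≥ 1`, `μ ∈ 𝒢(β, 0)`; (ii) if moreover `f ≥ 0` and `f ≢ 0`, then
`⟨T_{f,L}²⟩_μ ≥ c_f > 0` for all `0 ≤ β ≤ β_c`, `μ ∈ 𝒢(β, 0)` and `L ≥ L₀(f)` ("`L ≫ 1`":
for `L` below the inverse diameter of the support, `f(x/L)` may vanish on all of `ℤ^d`, so the
uniformity in `L` is for large `L`). Constants depend on `f` (and `d`) only.
Named fact (D-0014). [cite: AizenmanDuminilCopinAnnals2021, arXiv:1912.07973 p. 6 (display after Prop. 1.4)] [cite: Panis2023Triviality, §1.2.1 fn. 3 (p. 6)] -/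
def normalizedField_variance_bounds : Prop :=
  ∀ {d : ℕ}, 4 ≤ d → ∀ f : EuclideanSpace ℝ (Fin d) → ℝ, Continuous f → HasCompactSupport f →
    (∃ C : ℝ, ∀ (β L : ℝ), 0 ≤ β → β ≤ criticalBeta d → 1 ≤ L →
        ∀ μ ∈ isingGibbsMeasures d β 0, ∫ σ, normalizedField μ L f σ ^ 2 ∂μ ≤ C) ∧
    ((∀ x, 0 ≤ f x) → f ≠ 0 → ∃ c L₀ : ℝ, 0 < c ∧
        ∀ (β L : ℝ), 0 ≤ β → β ≤ criticalBeta d → L₀ ≤ L →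
        ∀ μ ∈ isingGibbsMeasures d β 0, c ≤ ∫ σ, normalizedField μ L f σ ^ 2 ∂μ)

/-! ### crit-ising.S13 in the printed regime -/

/-- **crit-ising.S13** (Gaussianity of scaling limits for `d ≥ 4`, *printed regime*;
Aizenman–Duminil-Copin, Ann. Math. 194 (2021), Prop. 1.4 and the Gaussianity corollary stated
after it (`d = 4`); Panis 2023, Thm 5.5 / Thm 1.2 "for `β ≤ β_c`, every sub-sequential scaling
limit is Gaussian" (`d ≥ 5`; originally Aizenman 1982, Fröhlich 1982)).
Let `d ≥ 4`; take `β_k ∈ [0, β_c(d)]`, meshes `δ_k → 0⁺`, renormalisations `ρ_k > 0`, DLR states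
`μ_k ∈ 𝒢(β_k, 0)`, and assume the printed near-critical regime, eventually in `k`: for `d = 4`,
`β_k = β_c` or (`β_k > 0` and `L_k := 1/δ_k ≤ M ξ(β_k)`, i.e. `ξ(β_k)⁻¹ ≤ M δ_k`, for a fixed
`M`: the scaling window `L = O(ξ(β))`; ADC: `L ≤ ξ(β)`, applied to the test function `f(·/M)`
at scale `L/M`); for `d ≥ 5`, `β_k ≥ β₀ > 0` (Panis: constant `C (β⁻⁴ ∨ β⁻²)`). If the fields
`Φ_k(f) = ρ_k δ_k^d ∑_x f(δ_k x) σ_x` have bounded second moments and converge in law, for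
every test function `f`, to `Φ(f)` for a linear random functional `Φ` on a probability space,
then `Φ` is a Gaussian generalised random field.

**Discrepancy with `isGaussianProcess_of_tendstoInDistribution_smearedSpin` (Sweep1).** That
statement quantifies over *arbitrary* sequences `(β_k, δ_k)` with `β_k ∈ [0, β_c]`, including
`β_k → 0` and, for `d = 4`, meshes much coarser than the inverse correlation length
(`δ_k ξ(β_k) → 0`, the massive / white-noise regime with varying temperature); these regimes
are not covered by the cited theorems (ADC Prop. 1.4 assumes `L ≤ ξ(β)`; Panis Thm 5.5 has a
constant diverging as `β → 0`; Aizenman 1982 treats pointwise limits of correlation functions),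
although Gaussianity is expected there as well (for fixed `β < β_c` the limit is Gaussian white
noise by Newman's central limit theorem for FKG systems with finite susceptibility: Panis 2023,
§1.2.1, fn. 2; ADC 2021, §1.2, fn. 1). The same over-generality (arbitrary `β(δ) ∈ [0, β_c]`)
is carried by the law-level formulation `highDim_triviality` of `FieldScalingLimit`. The hypothesis
`∀ k, 0 < ρ k` is kept for literal compatibility with `Sweep1` and is not used by the derivation.
This is the statement the sources print; it is derived from the three named facts above in Part II
below (`isGaussianProcess_of_tendstoInDistribution_smearedSpin_printRegime_of_bounds`).
Named fact (D-0014); one universe parameter (`Ω`). [cite: AizenmanDuminilCopinAnnals2021, arXiv:1912.07973 Prop. 1.4 and p. 6 (d = 4)] [cite: Panis2023Triviality, Thm. 5.5 (d ≥ 5)] -/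
def isGaussianProcess_of_tendstoInDistribution_smearedSpin_printRegime : Prop :=
  ∀ {d : ℕ}, 4 ≤ d → ∀ (β δ ρ : ℕ → ℝ), (∀ k, β k ∈ Set.Icc 0 (criticalBeta d)) →
    Tendsto δ atTop (𝓝[>] (0 : ℝ)) → (∀ k, 0 < ρ k) →
    (d = 4 → ∃ M : ℝ, ∀ᶠ k in atTop, β k = criticalBeta 4 ∨
      (0 < β k ∧ invCorrLength (twoPointPlus 4 (β k)) ≤ M * δ k)) →
    (5 ≤ d → ∃ β₀ : ℝ, 0 < β₀ ∧ ∀ᶠ k in atTop, β₀ ≤ β k) →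
    ∀ (μ : ℕ → ProbabilityMeasure (SpinConfig (Site d))),
      (∀ k, (μ k : Measure (SpinConfig (Site d))) ∈ isingGibbsMeasures d (β k) 0) →
    ∀ {Ω : Type*} [MeasurableSpace Ω] (P : Measure Ω) [IsProbabilityMeasure P]
      (Φ : TestFn d →ₗ[ℝ] Ω → ℝ),
      (∀ f : TestFn d, ∃ C : ℝ, ∀ k,
        ∫ σ, smearedSpin (ρ k) (δ k) f σ ^ 2 ∂(μ k : Measure (SpinConfig (Site d))) ≤ C) →
      (∀ f : TestFn d,
        TendstoInDistribution (fun k σ => smearedSpin (ρ k) (δ k) f σ) atTop (Φ f)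
          (fun k => (μ k : Measure (SpinConfig (Site d)))) P) →
      IsGaussianProcess (fun f ω => Φ f ω) P

universe u in
/-- The `Sweep1` formulation `isGaussianProcess_of_tendstoInDistribution_smearedSpin` implies the
printed-regime formulation, which has the same conclusion under two additional hypotheses (so
the correction is a restriction of scope, not a change of content). [folklore] -/
theorem isGaussianProcess_of_tendstoInDistribution_smearedSpin_printRegime_of_sweep1
    (h : isGaussianProcess_of_tendstoInDistribution_smearedSpin.{u}) :
    isGaussianProcess_of_tendstoInDistribution_smearedSpin_printRegime.{u} := by
  intro d hd β δ ρ hβ hδ hρ _ _ μ hμ Ω _ P _ Φ hM2 hCV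
  exact h hd β δ ρ hβ hδ hρ μ hμ P Φ hM2 hCV

end Literature.Probability.LatticeModels

/-!
## Part II. The probabilistic assembly (proofs)

We prove `isGaussianProcess_of_tendstoInDistribution_smearedSpin_printRegime` (the Gaussianity
of every scaling limit, in law, of the rescaled nearest-neighbour Ising spin field on `ℤ^d`,
`d ≥ 4`, in the regime covered by print) from the three printed estimates vendored as named
facts in Part I above:

* `aizenmanDuminilCopin_mgf_normalizedField_bound` (ADC 2021, Prop. 1.4, `d = 4`),
* `panis_mgf_normalizedField_bound` (Panis 2023, Thm 5.5, `d ≥ 5`),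
* `normalizedField_variance_bounds` (ADC 2021 p. 6 / Panis 2023 fn. 3).

This is the argument sketched in print after ADC Prop. 1.4 ("The claimed gaussianity follows
since … for `L ≫ 1` the distribution of `T_{f,L}(σ)` is approximately Gaussian of variance
`⟨T_{f,L}(σ)²⟩_β`") and after Panis Thm 1.2 ("As a consequence, for `β ≤ β_c`, every
sub-sequential scaling limit of the model is Gaussian"), made precise:

1. (`smearedSpin_eq_mul_normalizedField`) the field `Φ_k(f) = ρ_k δ_k^d ∑ f(δ_k x) σ_x` of
   `Sweep1` is `a_k T_{f,L_k}` with `L_k = 1/δ_k` and `a_k = ρ_k δ_k^d Σ_{L_k}^{1/2}`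
   independent of `f`; bounded second moments and the lower variance bound for one bump `f₀`
   bound `a_k` (Slutsky-type renormalisation step); for `d = 4` the window `L_k ≤ M ξ(β_k)` is
   reduced to the printed `L ≤ ξ(β)` by dilation covariance (`smearedSpin_dilate`,
   `tendsto_mgf_mul_exp_sub_one_of_window`): test `f(·/M)` at scale `L_k/M`;
2. the printed estimates (stated, as in print, for real exponential moments) then give
   `M_k(z) exp(-z² E[Φ_k(f)²]/2) → 1` for the moment generating function
   `M_k(z) = E[exp(z Φ_k(f))]`, `z ∈ ℝ`, and in particular uniformly bounded exponential
   moments;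
3. (`tendsto_integral_of_tendsto_of_sq_le`) convergence in distribution plus uniformly bounded
   second moments of a nonnegative continuous `F` gives convergence of `E[F(Φ_k(f))]` to
   `E[F(Φ(f))]` (truncation / uniform integrability), applied to `F = exp(z ·)`: `M_k(z) → M(z)`,
   the moment generating function of `Φ(f)`, finite everywhere;
4. (`exists_variance_of_tendsto_mgf`, pure analysis) hence `M(z) = exp(v z²/2)` for some
   `v ≥ 0`, so `law Φ(f) = N(0, v)` by uniqueness of laws with equal, everywhere finite, moment
   generating functions (`eqOn_complexMGF_of_mgf`, `Measure.ext_of_complexMGF_id_eq`), and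
   linearity of `Φ` upgrades one-dimensional Gaussianity to `IsGaussianProcess`
   (`isGaussian_of_map_eq_gaussianReal`).

## References

* M. Aizenman, H. Duminil-Copin, Ann. of Math. 194 (2021) 163–235, Prop. 1.4 and p. 6.
* R. Panis, Ann. Probab. 54 (2026) (arXiv:2309.05797, arXiv numbering), Thm 5.5, Thm 1.2.
-/

noncomputable section

open MeasureTheory ProbabilityTheory Filter Topology TopologicalSpace
open scoped NNReal BoundedContinuousFunction
open Literature.Probability.LatticeModels Literature.Probability.Percolation

namespace Literature.Probability.LatticeModels

variable {d : ℕ}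

/-! ### Lattice sums against compactly supported functions -/

/-- A compactly supported function on `ℝ^d` vanishes outside a cube `[-r, r]^d` with `r ≥ 1`.
[folklore] -/
theorem exists_cube_of_hasCompactSupport (f : EuclideanSpace ℝ (Fin d) → ℝ)
    (hf : HasCompactSupport f) : ∃ r : ℝ, 1 ≤ r ∧ ∀ x, f x ≠ 0 → ∀ i, |x i| ≤ r := by
  obtain ⟨R, hR⟩ := hf.isCompact.isBounded.subset_closedBall 0
  refine ⟨max R 1, le_max_right _ _, fun x hx i => ?_⟩
  have hx' : x ∈ tsupport f := subset_tsupport f (Function.mem_support.mpr hx)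
  have hxR := hR hx'
  rw [Metric.mem_closedBall, dist_zero_right] at hxR
  calc |x i| = ‖x i‖ := (Real.norm_eq_abs _).symm
    _ ≤ ‖x‖ := PiLp.norm_apply_le x i
    _ ≤ R := hxR
    _ ≤ max R 1 := le_max_left _ _

/-- For `δ ≠ 0` and `f` vanishing outside `[-r, r]^d`, the lattice sum `∑_x f(δ x) σ_x` is a
finite sum over the box `Λ_{r/|δ|}`. [folklore] -/
theorem finsum_smear_eq_sum {f : EuclideanSpace ℝ (Fin d) → ℝ} {r δ : ℝ} (hδ : δ ≠ 0)
    (hf : ∀ x, f x ≠ 0 → ∀ i, |x i| ≤ r) (σ : SpinConfig (Site d)) :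
    ∑ᶠ x : Site d, f (δ • siteVec x) * spinAt x σ =
      ∑ x ∈ latticeBox d (r / |δ|), f (δ • siteVec x) * spinAt x σ := by
  apply finsum_eq_finsetSum_of_support_subset
  intro x hx
  rw [Function.mem_support] at hx
  have hfx : f (δ • siteVec x) ≠ 0 := fun h => hx (by rw [h, zero_mul])
  rw [Finset.mem_coe, mem_latticeBox]
  intro i
  have h := hf _ hfx i
  rw [PiLp.smul_apply, siteVec_apply, smul_eq_mul, abs_mul] at h
  rw [le_div_iff₀ (abs_pos.mpr hδ), mul_comm]
  exact h

/-- A finite lattice sum `σ ↦ ∑_{x ∈ S} c_x σ_x` is measurable (`measurable_spinAt` of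
`Correlations`). [folklore] -/
theorem measurable_sum_mul_spinAt (S : Finset (Site d)) (c : Site d → ℝ) :
    Measurable fun σ : SpinConfig (Site d) => ∑ x ∈ S, c x * spinAt x σ :=
  Finset.measurable_sum S fun x _ => (measurable_spinAt x).const_mul (c x)

/-- The rescaled field `Φ_δ(f)` of `Sweep1` is measurable (for `δ ≠ 0` and `f` vanishing
outside a cube). [folklore] -/
theorem measurable_smearedSpin {f : EuclideanSpace ℝ (Fin d) → ℝ} {r : ℝ} (ρ : ℝ) {δ : ℝ}
    (hδ : δ ≠ 0) (hf : ∀ x, f x ≠ 0 → ∀ i, |x i| ≤ r) :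
    Measurable (smearedSpin ρ δ f : SpinConfig (Site d) → ℝ) := by
  have : (smearedSpin ρ δ f : SpinConfig (Site d) → ℝ) = fun σ =>
      ρ * δ ^ d * ∑ x ∈ latticeBox d (r / |δ|), f (δ • siteVec x) * spinAt x σ := by
    funext σ
    rw [smearedSpin, finsum_smear_eq_sum hδ hf]
  rw [this]
  exact (measurable_sum_mul_spinAt _ _).const_mul _

/-- The normalised field `T_{f,L}` is measurable (for `L ≠ 0` and `f` vanishing outside a cube).
[folklore] -/
theorem measurable_normalizedField (μ : Measure (SpinConfig (Site d)))
    {f : EuclideanSpace ℝ (Fin d) → ℝ} {r L : ℝ} (hL : L ≠ 0)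
    (hf : ∀ x, f x ≠ 0 → ∀ i, |x i| ≤ r) :
    Measurable (normalizedField μ L f) := by
  have : normalizedField μ L f = fun σ => (Real.sqrt (blockSpinVariance μ L))⁻¹ *
      ∑ x ∈ latticeBox d (r / |L⁻¹|), f (L⁻¹ • siteVec x) * spinAt x σ := by
    funext σ
    rw [normalizedField, finsum_smear_eq_sum (inv_ne_zero hL) hf]
  rw [this]
  exact (measurable_sum_mul_spinAt _ _).const_mul _

/-- **Renormalisation step.** For `δ > 0` and `L = 1/δ`, the field `Φ_δ(f) = ρ δ^d ∑ f(δx) σ_x`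
is the multiple `a · T_{f,L}` of the ADC-normalised field, `a = ρ δ^d Σ_L^{1/2}`, as soon as
`Σ_L(μ) > 0`; the factor `a` does not depend on `f`. [folklore] -/
theorem smearedSpin_eq_mul_normalizedField (μ : Measure (SpinConfig (Site d))) {ρ δ : ℝ}
    (hS : Real.sqrt (blockSpinVariance μ δ⁻¹) ≠ 0) (f : EuclideanSpace ℝ (Fin d) → ℝ)
    (σ : SpinConfig (Site d)) :
    smearedSpin ρ δ f σ =
      (ρ * δ ^ d * Real.sqrt (blockSpinVariance μ δ⁻¹)) * normalizedField μ δ⁻¹ f σ := by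
  simp only [smearedSpin, normalizedField, inv_inv]
  rw [mul_assoc (ρ * δ ^ d), ← mul_assoc (Real.sqrt _), mul_inv_cancel₀ hS, one_mul]

/-- **Dilation covariance of the rescaled field**: `Φ_{ρ,δ}(f) = Φ_{ρ/M^d, Mδ}(f(·/M))` for
`M ≠ 0` (testing `f` at mesh `δ` is testing the dilate `f(·/M)` at mesh `Mδ`, i.e. at scale
`L/M`). This is how the window `L ≤ M ξ(β)` is reduced to the printed one `L ≤ ξ(β)`.
[folklore] -/
theorem smearedSpin_dilate {ρ δ M : ℝ} (hM : M ≠ 0) (f : EuclideanSpace ℝ (Fin d) → ℝ)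
    (σ : SpinConfig (Site d)) :
    smearedSpin ρ δ f σ = smearedSpin (ρ / M ^ d) (M * δ) (fun y => f (M⁻¹ • y)) σ := by
  simp only [smearedSpin, smul_smul, inv_mul_cancel_left₀ hM]
  rw [mul_pow, ← mul_assoc, div_mul_cancel₀ ρ (pow_ne_zero d hM)]

/-- The dilate `f(·/M)` of a function vanishing outside `[-r, r]^d` vanishes outside
`[-M r, M r]^d` (`M > 0`). [folklore] -/
theorem cube_of_comp_inv_smul {f : EuclideanSpace ℝ (Fin d) → ℝ} {r M : ℝ}
    (hf : ∀ x, f x ≠ 0 → ∀ i, |x i| ≤ r) (hM : 0 < M) :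
    ∀ x, (fun y => f (M⁻¹ • y)) x ≠ 0 → ∀ i, |x i| ≤ M * r := by
  intro x hx i
  have h := hf _ hx i
  rw [PiLp.smul_apply, smul_eq_mul, abs_mul, abs_inv, abs_of_pos hM, inv_mul_le_iff₀ hM] at h
  exact h

/-- A nonnegative, not identically zero, smooth compactly supported test function exists (a bump).
[folklore] -/
theorem exists_testFn_nonneg_ne_zero (d : ℕ) :
    ∃ f₀ : TestFn d, (∀ x, 0 ≤ f₀ x) ∧ (f₀ : EuclideanSpace ℝ (Fin d) → ℝ) ≠ 0 := by
  let b : ContDiffBump (0 : EuclideanSpace ℝ (Fin d)) := ⟨1, 2, one_pos, one_lt_two⟩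
  refine ⟨⟨b, b.contDiff, b.hasCompactSupport, fun _ _ => trivial⟩, fun x => b.nonneg, ?_⟩
  intro h
  have h1 : (b : EuclideanSpace ℝ (Fin d) → ℝ) 0 = 1 :=
    b.one_of_mem_closedBall (Metric.mem_closedBall_self one_pos.le)
  have h0 := congr_fun h 0
  simp only [TestFunction.coe_mk, Pi.zero_apply] at h0
  rw [h0] at h1
  exact zero_ne_one h1

/-- The rescaled field is bounded: `|Φ_δ(f)(σ)| ≤ |ρ| |δ|^d ∑_{x ∈ Λ_{r/|δ|}} |f(δ x)|`.
[folklore] -/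
theorem abs_smearedSpin_le {f : EuclideanSpace ℝ (Fin d) → ℝ} {r : ℝ} (ρ : ℝ) {δ : ℝ}
    (hδ : δ ≠ 0) (hf : ∀ x, f x ≠ 0 → ∀ i, |x i| ≤ r) (σ : SpinConfig (Site d)) :
    |smearedSpin ρ δ f σ| ≤
      |ρ| * |δ| ^ d * ∑ x ∈ latticeBox d (r / |δ|), |f (δ • siteVec x)| := by
  rw [smearedSpin, finsum_smear_eq_sum hδ hf, abs_mul, abs_mul, abs_pow]
  gcongr
  refine (Finset.abs_sum_le_sum_abs _ _).trans (Finset.sum_le_sum fun x _ => ?_)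
  rw [abs_mul, abs_spinAt, mul_one]

/-- Exponential moments of the (bounded) rescaled field exist under any finite measure.
[folklore] -/
theorem integrable_exp_mul_smearedSpin (μ : Measure (SpinConfig (Site d))) [IsFiniteMeasure μ]
    {f : EuclideanSpace ℝ (Fin d) → ℝ} {r : ℝ} (ρ : ℝ) {δ : ℝ} (hδ : δ ≠ 0)
    (hf : ∀ x, f x ≠ 0 → ∀ i, |x i| ≤ r) (z : ℝ) :
    Integrable (fun σ => Real.exp (z * smearedSpin ρ δ f σ)) μ := by
  set M : ℝ := |ρ| * |δ| ^ d * ∑ x ∈ latticeBox d (r / |δ|), |f (δ • siteVec x)|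
  refine Integrable.of_bound
    ((Real.continuous_exp.measurable.comp
      ((measurable_smearedSpin ρ hδ hf).const_mul z)).aestronglyMeasurable)
    (Real.exp (|z| * M)) (Eventually.of_forall fun σ => ?_)
  rw [Real.norm_eq_abs, Real.abs_exp]
  refine Real.exp_le_exp.mpr ?_
  calc z * smearedSpin ρ δ f σ ≤ |z * smearedSpin ρ δ f σ| := le_abs_self _
    _ = |z| * |smearedSpin ρ δ f σ| := abs_mul _ _
    _ ≤ |z| * M := mul_le_mul_of_nonneg_left (abs_smearedSpin_le ρ hδ hf σ) (abs_nonneg z)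

/-! ### Three elementary probabilistic lemmas -/

/-- **Identification of the limit.** If real numbers `M_k(z)` (exponential moments) satisfy
`M_k(z) exp(-z² V_k/2) → 1` and `M_k(z) → M(z)` for every real `z`, with `V_k ≥ 0`
eventually, then `M(z) = exp(v z²/2)` for some `v ≥ 0` (`v = lim V_k`). [folklore] -/
theorem exists_variance_of_tendsto_mgf {M : ℕ → ℝ → ℝ} {Mlim : ℝ → ℝ} {V : ℕ → ℝ}
    (hV0 : ∀ᶠ k in atTop, 0 ≤ V k)
    (happrox : ∀ z : ℝ,
      Tendsto (fun k => M k z * Real.exp (-(z ^ 2 * V k / 2)) - 1) atTop (𝓝 0))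
    (hlim : ∀ z : ℝ, Tendsto (fun k => M k z) atTop (𝓝 (Mlim z))) :
    ∃ v : ℝ, 0 ≤ v ∧ ∀ z : ℝ, Mlim z = Real.exp (v * z ^ 2 / 2) := by
  -- the Gaussian exponential moments converge to `Mlim`
  have hg : ∀ z : ℝ, Tendsto (fun k => Real.exp (z ^ 2 * V k / 2)) atTop (𝓝 (Mlim z)) := by
    intro z
    have hu : Tendsto (fun k => M k z * Real.exp (-(z ^ 2 * V k / 2))) atTop (𝓝 1) := by
      have h := happrox z
      rw [← tendsto_sub_nhds_zero_iff] at h ⊢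
      simpa using h
    have hne : ∀ᶠ k in atTop, M k z * Real.exp (-(z ^ 2 * V k / 2)) ≠ 0 :=
      hu.eventually_ne one_ne_zero
    have h := (hlim z).mul (hu.inv₀ one_ne_zero)
    rw [inv_one, mul_one] at h
    refine h.congr' (hne.mono fun k hk => ?_)
    have hM : M k z ≠ 0 := fun h0 => hk (by rw [h0, zero_mul])
    rw [mul_inv, Real.exp_neg, inv_inv, ← mul_assoc, mul_inv_cancel₀ hM, one_mul]
  -- at `z = 1`
  have hg1 : Tendsto (fun k => Real.exp (V k / 2)) atTop (𝓝 (Mlim 1)) := by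
    refine (hg 1).congr fun k => ?_
    rw [one_pow, one_mul]
  set m : ℝ := Mlim 1 with hm_def
  have hm1 : 1 ≤ m :=
    ge_of_tendsto hg1 (hV0.mono fun k hk => Real.one_le_exp (by linarith))
  have hm_pos : 0 < m := one_pos.trans_le hm1
  set v : ℝ := 2 * Real.log m with hv_def
  have hV : Tendsto V atTop (𝓝 v) := by
    have hlog := ((Real.continuousAt_log hm_pos.ne').tendsto).comp hg1
    have h2 : Tendsto (fun k => 2 * Real.log (Real.exp (V k / 2))) atTop (𝓝 v) :=
      hlog.const_mul 2
    refine h2.congr fun k => ?_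
    rw [Real.log_exp]
    ring
  have hv0 : 0 ≤ v := by
    rw [hv_def]
    exact mul_nonneg zero_le_two (Real.log_nonneg hm1)
  refine ⟨v, hv0, fun z => ?_⟩
  have h1 : Tendsto (fun k => Real.exp (z ^ 2 * V k / 2)) atTop
      (𝓝 (Real.exp (z ^ 2 * v / 2))) :=
    (Real.continuous_exp.tendsto _).comp (((hV.const_mul (z ^ 2)).div_const 2))
  rw [tendsto_nhds_unique (hg z) h1]
  ring_nf

/-- A probability measure on `ℝ` whose moment generating function is `exp(v z²/2)` for all real
`z` (`v ≥ 0`) is the centred Gaussian of variance `v` (uniqueness of laws with equal, everywhere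
finite, moment generating functions, via Mathlib's `complexMGF`). [folklore] -/
theorem eq_gaussianReal_of_mgf_eq {ν : Measure ℝ} [IsProbabilityMeasure ν] {v : ℝ} (hv : 0 ≤ v)
    (hint : ∀ z : ℝ, Integrable (fun x => Real.exp (z * x)) ν)
    (h : ∀ z : ℝ, ∫ x, Real.exp (z * x) ∂ν = Real.exp (v * z ^ 2 / 2)) :
    ν = gaussianReal 0 v.toNNReal := by
  apply Measure.ext_of_complexMGF_id_eq
  have hmgf : mgf id ν = mgf id (gaussianReal 0 v.toNNReal) := by
    funext z
    rw [mgf_id_gaussianReal]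
    simp only [Real.coe_toNNReal _ hv, zero_mul, zero_add]
    simpa [mgf] using h z
  have heq := eqOn_complexMGF_of_mgf hmgf
  have hset : integrableExpSet id ν = Set.univ :=
    Set.eq_univ_of_forall fun z => by simpa [integrableExpSet] using hint z
  funext z
  exact heq (by simp [hset])

/-- **Convergence of moments under convergence in distribution.** If probability measures
`ν_k → ν₀` weakly on `ℝ` and a nonnegative continuous `F` has eventually uniformly bounded second
moments, `∫ F² dν_k ≤ B`, then `F ∈ L¹(ν₀)` and `∫ F dν_k → ∫ F dν₀` (truncate `F` at level
`M`, use `F - F ∧ M ≤ F²/M`). [folklore] -/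
theorem tendsto_integral_of_tendsto_of_sq_le {ν : ℕ → ProbabilityMeasure ℝ}
    {ν₀ : ProbabilityMeasure ℝ} (hν : Tendsto ν atTop (𝓝 ν₀)) {F : ℝ → ℝ} (hF : Continuous F)
    (hF0 : ∀ x, 0 ≤ F x) {B : ℝ}
    (hB : ∀ᶠ k in atTop, Integrable (fun x => F x ^ 2) (ν k : Measure ℝ) ∧
      ∫ x, F x ^ 2 ∂(ν k : Measure ℝ) ≤ B) :
    Integrable F (ν₀ : Measure ℝ) ∧
      Tendsto (fun k => ∫ x, F x ∂(ν k : Measure ℝ)) atTop (𝓝 (∫ x, F x ∂(ν₀ : Measure ℝ))) := by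
  have hB0 : 0 ≤ B := by
    obtain ⟨k, hk⟩ := hB.exists
    exact (integral_nonneg fun x => sq_nonneg _).trans hk.2
  -- truncations `F ∧ M` as bounded continuous functions
  have hmin0 : ∀ (M : ℕ) x, 0 ≤ min (F x) M := fun M x => le_min (hF0 x) M.cast_nonneg
  let FM : ℕ → ℝ →ᵇ ℝ := fun M => BoundedContinuousFunction.ofNormedAddCommGroup
    (fun x => min (F x) M) (hF.min continuous_const) M (fun x => by
      rw [Real.norm_eq_abs, abs_of_nonneg (hmin0 M x)]
      exact min_le_right _ _)
  have hFM : ∀ M x, FM M x = min (F x) M := fun M x => rfl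
  have hwk : ∀ M, Tendsto (fun k => ∫ x, FM M x ∂(ν k : Measure ℝ)) atTop
      (𝓝 (∫ x, FM M x ∂(ν₀ : Measure ℝ))) := fun M =>
    ProbabilityMeasure.tendsto_iff_forall_integral_tendsto.mp hν (FM M)
  -- pointwise inequalities
  have hpt : ∀ M : ℕ, 1 ≤ M → ∀ x, F x - min (F x) M ≤ F x ^ 2 / M := by
    intro M hM x
    have hMpos : (0 : ℝ) < M := by exact_mod_cast hM
    by_cases h : F x ≤ M
    · rw [min_eq_left h, sub_self]
      positivity
    · push Not at h
      rw [min_eq_right h.le, le_div_iff₀ hMpos]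
      nlinarith [hF0 x, h]
  have hpt0 : ∀ (M : ℕ) x, 0 ≤ F x - min (F x) M := fun M x => sub_nonneg.mpr (min_le_left _ _)
  have hF1 : ∀ x, F x ≤ 1 + F x ^ 2 := fun x => by nlinarith [hF0 x]
  -- good indices
  have hgood : ∀ᶠ k in atTop, Integrable F (ν k : Measure ℝ) ∧
      ∫ x, F x ∂(ν k : Measure ℝ) ≤ 1 + B ∧
      ∀ M : ℕ, 1 ≤ M →
        |∫ x, F x ∂(ν k : Measure ℝ) - ∫ x, FM M x ∂(ν k : Measure ℝ)| ≤ B / M := by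
    filter_upwards [hB] with k hk
    obtain ⟨hint2, hle⟩ := hk
    have hintF : Integrable F (ν k : Measure ℝ) :=
      ((integrable_const (1 : ℝ)).add hint2).mono' hF.aestronglyMeasurable
        (Eventually.of_forall fun x => by
          rw [Real.norm_eq_abs, abs_of_nonneg (hF0 x)]
          exact hF1 x)
    refine ⟨hintF, ?_, fun M hM => ?_⟩
    · calc ∫ x, F x ∂(ν k : Measure ℝ) ≤ ∫ x, (1 + F x ^ 2) ∂(ν k : Measure ℝ) :=
            integral_mono hintF ((integrable_const _).add hint2) hF1
        _ = 1 + ∫ x, F x ^ 2 ∂(ν k : Measure ℝ) := by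
            rw [integral_add (integrable_const _) hint2]
            simp
        _ ≤ 1 + B := by linarith
    · have hMpos : (0 : ℝ) < M := by exact_mod_cast hM
      have hintFM : Integrable (FM M) (ν k : Measure ℝ) := (FM M).integrable _
      rw [← integral_sub hintF hintFM,
        abs_of_nonneg (integral_nonneg fun x => hpt0 M x)]
      calc ∫ x, (F x - FM M x) ∂(ν k : Measure ℝ) ≤ ∫ x, F x ^ 2 / M ∂(ν k : Measure ℝ) :=
            integral_mono (hintF.sub hintFM) (hint2.div_const _) fun x => hpt M hM x
        _ = (∫ x, F x ^ 2 ∂(ν k : Measure ℝ)) / M := integral_div _ _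
        _ ≤ B / M := by gcongr
  -- integrability at the limit
  have hFMle : ∀ M : ℕ, ∫ x, FM M x ∂(ν₀ : Measure ℝ) ≤ 1 + B := by
    intro M
    refine le_of_tendsto (hwk M) ?_
    filter_upwards [hgood] with k hk
    calc ∫ x, FM M x ∂(ν k : Measure ℝ) ≤ ∫ x, F x ∂(ν k : Measure ℝ) :=
          integral_mono ((FM M).integrable _) hk.1 fun x => min_le_left _ _
      _ ≤ 1 + B := hk.2.1
  have hint0 : Integrable F (ν₀ : Measure ℝ) := by
    refine ⟨hF.aestronglyMeasurable, ?_⟩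
    rw [hasFiniteIntegral_iff_ofReal (Eventually.of_forall hF0)]
    have hsup : ∀ x, ENNReal.ofReal (F x) = ⨆ M : ℕ, ENNReal.ofReal (min (F x) M) := by
      intro x
      apply le_antisymm
      · obtain ⟨M, hM⟩ := exists_nat_ge (F x)
        exact le_iSup_of_le M (by rw [min_eq_left hM])
      · exact iSup_le fun M => ENNReal.ofReal_le_ofReal (min_le_left _ _)
    have hmeas : ∀ M : ℕ, Measurable fun x => ENNReal.ofReal (min (F x) M) := fun M =>
      (hF.min continuous_const).measurable.ennreal_ofReal
    have hmono : Monotone fun (M : ℕ) x => ENNReal.ofReal (min (F x) M) :=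
      fun M N hMN x => ENNReal.ofReal_le_ofReal (min_le_min_left _ (Nat.cast_le.mpr hMN))
    calc ∫⁻ x, ENNReal.ofReal (F x) ∂(ν₀ : Measure ℝ)
        = ∫⁻ x, ⨆ M : ℕ, ENNReal.ofReal (min (F x) M) ∂(ν₀ : Measure ℝ) :=
          lintegral_congr fun x => hsup x
      _ = ⨆ M : ℕ, ∫⁻ x, ENNReal.ofReal (min (F x) M) ∂(ν₀ : Measure ℝ) :=
          lintegral_iSup hmeas hmono
      _ ≤ ENNReal.ofReal (1 + B) := iSup_le fun M => by
          have h := ofReal_integral_eq_lintegral_ofReal ((FM M).integrable (ν₀ : Measure ℝ))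
            (Eventually.of_forall fun x => hmin0 M x)
          refine le_trans (le_of_eq ?_) (ENNReal.ofReal_le_ofReal (hFMle M))
          exact h.symm
      _ < ⊤ := ENNReal.ofReal_lt_top
  -- dominated convergence at the limit
  have hdc : Tendsto (fun M : ℕ => ∫ x, FM M x ∂(ν₀ : Measure ℝ)) atTop
      (𝓝 (∫ x, F x ∂(ν₀ : Measure ℝ))) := by
    refine tendsto_integral_of_dominated_convergence F
      (fun M => (FM M).continuous.aestronglyMeasurable) hint0
      (fun M => Eventually.of_forall fun x => ?_) (Eventually.of_forall fun x => ?_)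
    · rw [Real.norm_eq_abs, hFM, abs_of_nonneg (hmin0 M x)]
      exact min_le_left _ _
    · refine tendsto_atTop_of_eventually_const (i₀ := ⌈F x⌉₊) fun M hM => ?_
      rw [hFM, min_eq_left ((Nat.le_ceil (F x)).trans (Nat.cast_le.mpr hM))]
  -- conclusion: an `ε/3` argument
  refine ⟨hint0, Metric.tendsto_atTop.mpr fun ε hε => ?_⟩
  obtain ⟨M₁, hM₁⟩ := Metric.tendsto_atTop.mp hdc (ε / 3) (by positivity)
  obtain ⟨M₂, hM₂⟩ := exists_nat_gt (3 * B / ε)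
  obtain ⟨N₂, hN₂⟩ := eventually_atTop.mp hgood
  set M : ℕ := max (max M₁ M₂) 1 with hM_def
  have hM1 : 1 ≤ M := le_max_right _ _
  have hMpos : (0 : ℝ) < M := by exact_mod_cast hM1
  have hBM : B / M < ε / 3 := by
    have h2 : (M₂ : ℝ) ≤ M := by exact_mod_cast (le_max_right M₁ M₂).trans (le_max_left _ 1)
    rw [div_lt_iff₀ hMpos]
    rw [div_lt_iff₀ hε] at hM₂
    nlinarith
  obtain ⟨N₁, hN₁⟩ := Metric.tendsto_atTop.mp (hwk M) (ε / 3) (by positivity)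
  refine ⟨max N₁ N₂, fun k hk => ?_⟩
  have hgk := hN₂ k (le_of_max_le_right hk)
  have hwk' := hN₁ k (le_of_max_le_left hk)
  have h3 := hM₁ M ((le_max_left M₁ M₂).trans (le_max_left _ 1))
  have h1 : dist (∫ x, F x ∂(ν k : Measure ℝ)) (∫ x, FM M x ∂(ν k : Measure ℝ)) < ε / 3 := by
    rw [Real.dist_eq]
    exact (hgk.2.2 M hM1).trans_lt hBM
  calc dist (∫ x, F x ∂(ν k : Measure ℝ)) (∫ x, F x ∂(ν₀ : Measure ℝ))
      ≤ dist (∫ x, F x ∂(ν k : Measure ℝ)) (∫ x, FM M x ∂(ν k : Measure ℝ)) +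
          dist (∫ x, FM M x ∂(ν k : Measure ℝ)) (∫ x, FM M x ∂(ν₀ : Measure ℝ)) +
          dist (∫ x, FM M x ∂(ν₀ : Measure ℝ)) (∫ x, F x ∂(ν₀ : Measure ℝ)) :=
        dist_triangle4 _ _ _ _
    _ < ε / 3 + ε / 3 + ε / 3 := by gcongr
    _ = ε := by ring

/-! ### The assembly -/

/-- **Core estimate (one test function).** In the setting of
`isGaussianProcess_of_tendstoInDistribution_smearedSpin_printRegime`, with `μ_k` plain measures,
the printed estimates give `M_k(z) exp(-z² E[Φ_k(g)²]/2) - 1 → 0` for the exponential moments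
`M_k(z) = E[exp(z Φ_k(g))]`, `z ∈ ℝ`, of the rescaled field tested against a continuous compactly
supported `g`, provided the second moments of `Φ_k(g)` and of `Φ_k(f₀)` for one nonnegative
`f₀ ≢ 0` are bounded (ADC 2021, p. 6; Panis 2023, after Thm 1.2). Printed window: for `d = 4`,
eventually `β_k = β_c` or `L_k = 1/δ_k ≤ ξ(β_k)`; for `d ≥ 5`, eventually `β_k ≥ β₀ > 0`. [cite: AizenmanDuminilCopinAnnals2021, arXiv:1912.07973 Prop. 1.4 and p. 6] -/
theorem tendsto_mgf_mul_exp_sub_one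
    (h₁ : aizenmanDuminilCopin_mgf_normalizedField_bound)
    (h₂ : normalizedField_variance_bounds)
    (h₃ : panis_mgf_normalizedField_bound)
    (hd : 4 ≤ d) {β δ ρ : ℕ → ℝ} (hβ : ∀ k, β k ∈ Set.Icc 0 (criticalBeta d))
    (hδ : Tendsto δ atTop (𝓝[>] (0 : ℝ)))
    (h4 : d = 4 → ∀ᶠ k in atTop, β k = criticalBeta 4 ∨
      (0 < β k ∧ invCorrLength (twoPointPlus 4 (β k)) ≤ δ k))
    (h5 : 5 ≤ d → ∃ β₀ : ℝ, 0 < β₀ ∧ ∀ᶠ k in atTop, β₀ ≤ β k)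
    {μ : ℕ → Measure (SpinConfig (Site d))}
    (hμ : ∀ k, μ k ∈ isingGibbsMeasures d (β k) 0)
    {g : EuclideanSpace ℝ (Fin d) → ℝ} (hg : Continuous g) (hgs : HasCompactSupport g)
    {Cg : ℝ} (hCg : ∀ k, ∫ σ, smearedSpin (ρ k) (δ k) g σ ^ 2 ∂μ k ≤ Cg)
    {f₀ : EuclideanSpace ℝ (Fin d) → ℝ} (hf₀ : Continuous f₀) (hf₀s : HasCompactSupport f₀)
    (hf₀0 : ∀ x, 0 ≤ f₀ x) (hf₀ne : f₀ ≠ 0)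
    {C₀ : ℝ} (hC₀ : ∀ k, ∫ σ, smearedSpin (ρ k) (δ k) f₀ σ ^ 2 ∂μ k ≤ C₀) (z : ℝ) :
    Tendsto (fun k =>
      (∫ σ, Real.exp (z * smearedSpin (ρ k) (δ k) g σ) ∂μ k) *
          Real.exp (-(z ^ 2 * (∫ σ, smearedSpin (ρ k) (δ k) g σ ^ 2 ∂μ k) / 2)) - 1)
      atTop (𝓝 0) := by
  -- meshes: `δ_k > 0` eventually and `L_k = 1/δ_k → ∞`
  have hδpos : ∀ᶠ k in atTop, 0 < δ k := hδ.eventually (eventually_mem_nhdsWithin)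
  have hLtop : Tendsto (fun k => (δ k)⁻¹) atTop atTop := tendsto_inv_nhdsGT_zero.comp hδ
  obtain ⟨r, hr1, hgr⟩ := exists_cube_of_hasCompactSupport g hgs
  -- variance bounds: upper for `|g|`, lower for the bump `f₀`
  obtain ⟨Cabs, hCabs⟩ := (h₂ hd (fun x => |g x|) hg.abs (hgs.comp_left abs_zero)).1
  obtain ⟨c₀, L₀, hc₀, hlow⟩ := (h₂ hd f₀ hf₀ hf₀s).2 hf₀0 hf₀ne
  set A2 : ℝ := C₀ / c₀ with hA2
  have hA2nn : 0 ≤ A2 :=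
    div_nonneg ((integral_nonneg fun σ => sq_nonneg _).trans (hC₀ 0)) hc₀.le
  have hev : ∀ᶠ k in atTop, 0 < δ k ∧ 1 < (δ k)⁻¹ ∧ L₀ ≤ (δ k)⁻¹ :=
    (hδpos.and (hLtop.eventually (eventually_gt_atTop 1))).and
      (hLtop.eventually (eventually_ge_atTop L₀)) |>.mono fun k hk => ⟨hk.1.1, hk.1.2, hk.2⟩
  -- per-`k` renormalisation: `Φ_k(f) = a_k T_{f,L_k}` with `a_k² ≤ A2`
  have hren : ∀ k, 0 < δ k → L₀ ≤ (δ k)⁻¹ →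
      ∃ a : ℝ, a ^ 2 ≤ A2 ∧ ∀ (f : EuclideanSpace ℝ (Fin d) → ℝ) (σ : SpinConfig (Site d)),
        smearedSpin (ρ k) (δ k) f σ = a * normalizedField (μ k) (δ k)⁻¹ f σ := by
    intro k hδk hLL₀
    have hlowk := hlow (β k) (δ k)⁻¹ (hβ k).1 (hβ k).2 hLL₀ (μ k) (hμ k)
    have hS0 : Real.sqrt (blockSpinVariance (μ k) (δ k)⁻¹) ≠ 0 := by
      intro hS0
      have h0 : ∀ σ, normalizedField (μ k) (δ k)⁻¹ f₀ σ = 0 := fun σ => by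
        rw [normalizedField, hS0, inv_zero, zero_mul]
      have : ∫ σ, normalizedField (μ k) (δ k)⁻¹ f₀ σ ^ 2 ∂μ k = 0 := by simp [h0]
      linarith
    refine ⟨ρ k * δ k ^ d * Real.sqrt (blockSpinVariance (μ k) (δ k)⁻¹), ?_,
      fun f σ => smearedSpin_eq_mul_normalizedField (μ k) hS0 f σ⟩
    set a := ρ k * δ k ^ d * Real.sqrt (blockSpinVariance (μ k) (δ k)⁻¹) with ha
    have h1 : a ^ 2 * ∫ σ, normalizedField (μ k) (δ k)⁻¹ f₀ σ ^ 2 ∂μ k ≤ C₀ := by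
      have h := hC₀ k
      have heq : ∀ σ, smearedSpin (ρ k) (δ k) f₀ σ ^ 2 =
          a ^ 2 * normalizedField (μ k) (δ k)⁻¹ f₀ σ ^ 2 := fun σ => by
        rw [smearedSpin_eq_mul_normalizedField (μ k) hS0 f₀ σ, mul_pow]
      simp_rw [heq, integral_const_mul] at h
      exact h
    rw [hA2, le_div_iff₀ hc₀]
    calc a ^ 2 * c₀ ≤ a ^ 2 * ∫ σ, normalizedField (μ k) (δ k)⁻¹ f₀ σ ^ 2 ∂μ k :=
        mul_le_mul_of_nonneg_left hlowk (sq_nonneg a)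
      _ ≤ C₀ := h1
  -- the two printed regimes
  rcases hd.eq_or_lt with rfl | hlt
  · -- `d = 4`: Aizenman–Duminil-Copin
    obtain ⟨c, C, hc, hC, H⟩ := h₁
    have hu : Tendsto (fun k => (Real.log (δ k)⁻¹ ^ c)⁻¹) atTop (𝓝 0) :=
      tendsto_inv_atTop_zero.comp
        ((tendsto_rpow_atTop hc).comp (Real.tendsto_log_atTop.comp hLtop))
    refine squeeze_zero_norm' (a := fun k =>
      (C * (⨆ x, |g x|) ^ 4 * r ^ 12 * (A2 ^ 2 * z ^ 4)) * (Real.log (δ k)⁻¹ ^ c)⁻¹)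
      ((hev.and (h4 rfl)).mono fun k hk => ?_) (by simpa using tendsto_const_nhds.mul hu)
    obtain ⟨⟨hδk, hL1, hLL₀⟩, h4k⟩ := hk
    obtain ⟨a, ha2, hX⟩ := hren k hδk hLL₀
    have hreg : β k = criticalBeta 4 ∨
        (0 < β k ∧ (δ k)⁻¹ * invCorrLength (twoPointPlus 4 (β k)) ≤ 1) := by
      rcases h4k with h | ⟨hpos, hle⟩
      · exact Or.inl h
      · exact Or.inr ⟨hpos, by rwa [inv_mul_le_iff₀ hδk, mul_one]⟩
    have hest := H (β k) (δ k)⁻¹ r (hβ k).1 (hβ k).2 hreg hL1 hr1 (μ k) (hμ k) g hg hgr (a * z)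
    -- identify `E[exp(zX - z²V/2)]` with the printed quantity at `u = a z`
    have hV : (∫ σ, smearedSpin (ρ k) (δ k) g σ ^ 2 ∂μ k) =
        a ^ 2 * ∫ σ, normalizedField (μ k) (δ k)⁻¹ g σ ^ 2 ∂μ k := by
      have heq : ∀ σ, smearedSpin (ρ k) (δ k) g σ ^ 2 =
          a ^ 2 * normalizedField (μ k) (δ k)⁻¹ g σ ^ 2 := fun σ => by rw [hX g σ, mul_pow]
      simp_rw [heq, integral_const_mul]
    have hI : (∫ σ, Real.exp (z * smearedSpin (ρ k) (δ k) g σ) ∂μ k) *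
          Real.exp (-(z ^ 2 * (∫ σ, smearedSpin (ρ k) (δ k) g σ ^ 2 ∂μ k) / 2)) =
        ∫ σ, Real.exp (a * z * normalizedField (μ k) (δ k)⁻¹ g σ -
          (a * z) ^ 2 / 2 * ∫ σ', normalizedField (μ k) (δ k)⁻¹ g σ' ^ 2 ∂μ k) ∂μ k := by
      rw [← integral_mul_const]
      refine integral_congr_ae (Eventually.of_forall fun σ => ?_)
      dsimp only
      rw [← Real.exp_add, hX g σ, hV]
      ring_nf
    rw [Real.norm_eq_abs, hI]
    have hlogpos : 0 < Real.log (δ k)⁻¹ ^ c := Real.rpow_pos_of_pos (Real.log_pos hL1) c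
    calc |(∫ σ, Real.exp (a * z * normalizedField (μ k) (δ k)⁻¹ g σ -
            (a * z) ^ 2 / 2 * ∫ σ', normalizedField (μ k) (δ k)⁻¹ g σ' ^ 2 ∂μ k) ∂μ k) - 1|
        ≤ C * (⨆ x, |g x|) ^ 4 * r ^ 12 * (a * z) ^ 4 / Real.log (δ k)⁻¹ ^ c := hest
      _ ≤ (C * (⨆ x, |g x|) ^ 4 * r ^ 12 * (A2 ^ 2 * z ^ 4)) * (Real.log (δ k)⁻¹ ^ c)⁻¹ := by
          rw [div_eq_mul_inv]
          gcongr
          calc (a * z) ^ 4 = (a ^ 2) ^ 2 * z ^ 4 := by ring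
            _ ≤ A2 ^ 2 * z ^ 4 := by gcongr
  · -- `d ≥ 5`: Panis (Aizenman, Fröhlich)
    have hd5 : 5 ≤ d := hlt
    obtain ⟨β₀, hβ₀, hβ₀k⟩ := h5 hd5
    obtain ⟨C, γ, hC, hγ, H⟩ := h₃ hd5
    have hu : Tendsto (fun k => ((δ k)⁻¹ ^ (d - 4))⁻¹) atTop (𝓝 0) :=
      tendsto_inv_atTop_zero.comp ((tendsto_pow_atTop (by omega)).comp hLtop)
    refine squeeze_zero_norm' (a := fun k =>
      (Real.exp (z ^ 2 / 2 * (A2 * Cabs)) * (C * max (β₀ ^ (-4 : ℤ)) (β₀ ^ (-2 : ℤ)) *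
        (⨆ x, |g x|) ^ 4 * r ^ γ * (A2 ^ 2 * z ^ 4))) * ((δ k)⁻¹ ^ (d - 4))⁻¹)
      ((hev.and hβ₀k).mono fun k hk => ?_) (by simpa using tendsto_const_nhds.mul hu)
    obtain ⟨⟨hδk, hL1, hLL₀⟩, hβ₀k⟩ := hk
    obtain ⟨a, ha2, hX⟩ := hren k hδk hLL₀
    have hβk : 0 < β k := hβ₀.trans_le hβ₀k
    have hest := H (β k) (δ k)⁻¹ r hβk (hβ k).2 hL1.le hr1 (μ k) (hμ k) g hg hgr (a * z)
    have hV : (∫ σ, smearedSpin (ρ k) (δ k) g σ ^ 2 ∂μ k) =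
        a ^ 2 * ∫ σ, normalizedField (μ k) (δ k)⁻¹ g σ ^ 2 ∂μ k := by
      have heq : ∀ σ, smearedSpin (ρ k) (δ k) g σ ^ 2 =
          a ^ 2 * normalizedField (μ k) (δ k)⁻¹ g σ ^ 2 := fun σ => by rw [hX g σ, mul_pow]
      simp_rw [heq, integral_const_mul]
    have hM : (∫ σ, Real.exp (z * smearedSpin (ρ k) (δ k) g σ) ∂μ k) =
        ∫ σ, Real.exp (a * z * normalizedField (μ k) (δ k)⁻¹ g σ) ∂μ k := by
      refine integral_congr_ae (Eventually.of_forall fun σ => ?_)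
      dsimp only
      rw [hX g σ]
      ring_nf
    set s : ℝ := (a * z) ^ 2 / 2 * ∫ σ, normalizedField (μ k) (δ k)⁻¹ g σ ^ 2 ∂μ k with hs_def
    have hs : z ^ 2 * (∫ σ, smearedSpin (ρ k) (δ k) g σ ^ 2 ∂μ k) / 2 = s := by
      rw [hs_def, hV]
      ring
    have hs0 : 0 ≤ s := mul_nonneg (by positivity) (integral_nonneg fun σ => sq_nonneg _)
    -- the prefactor `exp((az)²/2 ⟨T_{|g|}²⟩)` is bounded via the upper variance bound
    have hW : (a * z) ^ 2 / 2 * ∫ σ, normalizedField (μ k) (δ k)⁻¹ (fun x => |g x|) σ ^ 2 ∂μ k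
        ≤ z ^ 2 / 2 * (A2 * Cabs) := by
      have hIle := hCabs (β k) (δ k)⁻¹ (hβ k).1 (hβ k).2 hL1.le (μ k) (hμ k)
      have hI0 : 0 ≤ ∫ σ, normalizedField (μ k) (δ k)⁻¹ (fun x => |g x|) σ ^ 2 ∂μ k :=
        integral_nonneg fun σ => sq_nonneg _
      calc (a * z) ^ 2 / 2 * ∫ σ, normalizedField (μ k) (δ k)⁻¹ (fun x => |g x|) σ ^ 2 ∂μ k
          = z ^ 2 / 2 * (a ^ 2 *
              ∫ σ, normalizedField (μ k) (δ k)⁻¹ (fun x => |g x|) σ ^ 2 ∂μ k) := by ring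
        _ ≤ z ^ 2 / 2 * (A2 * Cabs) := by gcongr
    have hmax : max (β k ^ (-4 : ℤ)) (β k ^ (-2 : ℤ)) ≤ max (β₀ ^ (-4 : ℤ)) (β₀ ^ (-2 : ℤ)) := by
      refine max_le_max ?_ ?_ <;>
      · rw [zpow_neg, zpow_neg, zpow_ofNat, zpow_ofNat]
        exact inv_anti₀ (pow_pos hβ₀ _) (pow_le_pow_left₀ hβ₀.le hβ₀k _)
    have hLpos : 0 < (δ k)⁻¹ ^ (d - 4) := pow_pos (inv_pos.mpr hδk) _
    -- `|M e^{-s} - 1| = e^{-s} |M - e^{s}| ≤ |M - e^{s}|`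
    have hkey : ∀ M : ℝ, |M * Real.exp (-s) - 1| ≤ |M - Real.exp s| := by
      intro M
      have h1 : M * Real.exp (-s) - 1 = Real.exp (-s) * (M - Real.exp s) := by
        rw [mul_sub, Real.exp_neg, ← mul_comm M, inv_mul_cancel₀ (Real.exp_pos s).ne']
      rw [h1, abs_mul, Real.abs_exp]
      exact mul_le_of_le_one_left (abs_nonneg _) (Real.exp_le_one_iff.mpr (neg_nonpos.mpr hs0))
    rw [Real.norm_eq_abs, hs, hM]
    refine (hkey _).trans ?_
    calc |(∫ σ, Real.exp (a * z * normalizedField (μ k) (δ k)⁻¹ g σ) ∂μ k) - Real.exp s|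
        ≤ Real.exp ((a * z) ^ 2 / 2 *
              ∫ σ, normalizedField (μ k) (δ k)⁻¹ (fun x => |g x|) σ ^ 2 ∂μ k) *
            (C * max (β k ^ (-4 : ℤ)) (β k ^ (-2 : ℤ)) * (⨆ x, |g x|) ^ 4 * r ^ γ *
              (a * z) ^ 4 / (δ k)⁻¹ ^ (d - 4)) := hest
      _ ≤ Real.exp (z ^ 2 / 2 * (A2 * Cabs)) *
            (C * max (β₀ ^ (-4 : ℤ)) (β₀ ^ (-2 : ℤ)) * (⨆ x, |g x|) ^ 4 * r ^ γ *
              (A2 ^ 2 * z ^ 4) / (δ k)⁻¹ ^ (d - 4)) := by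
          have hrγ : 0 ≤ r ^ γ := Real.rpow_nonneg (zero_le_one.trans hr1) γ
          have hr0 : 0 < r := one_pos.trans_le hr1
          gcongr
          calc (a * z) ^ 4 = (a ^ 2) ^ 2 * z ^ 4 := by ring
            _ ≤ A2 ^ 2 * z ^ 4 := by gcongr
      _ = (Real.exp (z ^ 2 / 2 * (A2 * Cabs)) * (C * max (β₀ ^ (-4 : ℤ)) (β₀ ^ (-2 : ℤ)) *
            (⨆ x, |g x|) ^ 4 * r ^ γ * (A2 ^ 2 * z ^ 4))) * ((δ k)⁻¹ ^ (d - 4))⁻¹ := by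
          ring

/-- **Core estimate in the window `L = O(ξ(β))`.** The same conclusion as
`tendsto_mgf_mul_exp_sub_one` when, for `d = 4`, the printed condition `L_k ≤ ξ(β_k)` is
relaxed to `L_k ≤ M ξ(β_k)` (`ξ(β_k)⁻¹ ≤ M δ_k`) for a fixed `M ≥ 1`: by dilation covariance
(`smearedSpin_dilate`) the field tested against `g` at mesh `δ_k` is the field tested against
`g(·/M)` at mesh `M δ_k`, i.e. at scale `L_k / M ≤ ξ(β_k)`, where ADC Prop. 1.4 applies.
[cite: AizenmanDuminilCopinAnnals2021, arXiv:1912.07973 Prop. 1.4 and p. 6] -/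
theorem tendsto_mgf_mul_exp_sub_one_of_window
    (h₁ : aizenmanDuminilCopin_mgf_normalizedField_bound)
    (h₂ : normalizedField_variance_bounds)
    (h₃ : panis_mgf_normalizedField_bound)
    (hd : 4 ≤ d) {β δ ρ : ℕ → ℝ} (hβ : ∀ k, β k ∈ Set.Icc 0 (criticalBeta d))
    (hδ : Tendsto δ atTop (𝓝[>] (0 : ℝ))) {M : ℝ} (hM : 1 ≤ M)
    (h4 : d = 4 → ∀ᶠ k in atTop, β k = criticalBeta 4 ∨
      (0 < β k ∧ invCorrLength (twoPointPlus 4 (β k)) ≤ M * δ k))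
    (h5 : 5 ≤ d → ∃ β₀ : ℝ, 0 < β₀ ∧ ∀ᶠ k in atTop, β₀ ≤ β k)
    {μ : ℕ → Measure (SpinConfig (Site d))}
    (hμ : ∀ k, μ k ∈ isingGibbsMeasures d (β k) 0)
    {g : EuclideanSpace ℝ (Fin d) → ℝ} (hg : Continuous g) (hgs : HasCompactSupport g)
    {Cg : ℝ} (hCg : ∀ k, ∫ σ, smearedSpin (ρ k) (δ k) g σ ^ 2 ∂μ k ≤ Cg)
    {f₀ : EuclideanSpace ℝ (Fin d) → ℝ} (hf₀ : Continuous f₀) (hf₀s : HasCompactSupport f₀)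
    (hf₀0 : ∀ x, 0 ≤ f₀ x) (hf₀ne : f₀ ≠ 0)
    {C₀ : ℝ} (hC₀ : ∀ k, ∫ σ, smearedSpin (ρ k) (δ k) f₀ σ ^ 2 ∂μ k ≤ C₀) (z : ℝ) :
    Tendsto (fun k =>
      (∫ σ, Real.exp (z * smearedSpin (ρ k) (δ k) g σ) ∂μ k) *
          Real.exp (-(z ^ 2 * (∫ σ, smearedSpin (ρ k) (δ k) g σ ^ 2 ∂μ k) / 2)) - 1)
      atTop (𝓝 0) := by
  have hM0 : 0 < M := one_pos.trans_le hM
  have hMne : M ≠ 0 := hM0.ne'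
  -- dilated data: mesh `M δ_k`, renormalisation `ρ_k / M^d`, test functions `g(·/M)`, `f₀(·/M)`
  have hδ' : Tendsto (fun k => M * δ k) atTop (𝓝[>] (0 : ℝ)) := by
    rw [tendsto_nhdsWithin_iff] at hδ ⊢
    refine ⟨by simpa using hδ.1.const_mul M, hδ.2.mono fun k hk => ?_⟩
    exact mul_pos hM0 hk
  have hgc : Continuous fun y : EuclideanSpace ℝ (Fin d) => g (M⁻¹ • y) :=
    hg.comp (continuous_const_smul M⁻¹)
  have hgs' : HasCompactSupport fun y : EuclideanSpace ℝ (Fin d) => g (M⁻¹ • y) :=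
    hgs.comp_smul (inv_ne_zero hMne)
  have hfc : Continuous fun y : EuclideanSpace ℝ (Fin d) => f₀ (M⁻¹ • y) :=
    hf₀.comp (continuous_const_smul M⁻¹)
  have hfs' : HasCompactSupport fun y : EuclideanSpace ℝ (Fin d) => f₀ (M⁻¹ • y) :=
    hf₀s.comp_smul (inv_ne_zero hMne)
  have hf0' : ∀ x, 0 ≤ (fun y : EuclideanSpace ℝ (Fin d) => f₀ (M⁻¹ • y)) x := fun x => hf₀0 _
  have hfne' : (fun y : EuclideanSpace ℝ (Fin d) => f₀ (M⁻¹ • y)) ≠ 0 := by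
    intro h
    apply hf₀ne
    funext x
    have hx := congr_fun h (M • x)
    simp only [smul_smul, inv_mul_cancel₀ hMne, one_smul, Pi.zero_apply] at hx
    exact hx
  have hCg' : ∀ k, ∫ σ, smearedSpin (ρ k / M ^ d) (M * δ k) (fun y => g (M⁻¹ • y)) σ ^ 2 ∂μ k
      ≤ Cg := fun k => by
    have h := hCg k
    simp_rw [smearedSpin_dilate hMne g] at h
    exact h
  have hC₀' : ∀ k, ∫ σ, smearedSpin (ρ k / M ^ d) (M * δ k) (fun y => f₀ (M⁻¹ • y)) σ ^ 2 ∂μ k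
      ≤ C₀ := fun k => by
    have h := hC₀ k
    simp_rw [smearedSpin_dilate hMne f₀] at h
    exact h
  have key := tendsto_mgf_mul_exp_sub_one h₁ h₂ h₃ hd hβ hδ' (ρ := fun k => ρ k / M ^ d)
    h4 h5 hμ hgc hgs' hCg' hfc hfs' hf0' hfne' hC₀' z
  refine key.congr fun k => ?_
  simp_rw [← smearedSpin_dilate hMne g]

/-- **crit-ising.S13, printed regime, from the printed estimates.** The Gaussianity of scaling
limits `isGaussianProcess_of_tendstoInDistribution_smearedSpin_printRegime` follows from
Aizenman–Duminil-Copin 2021 Prop. 1.4 (`d = 4`), Panis 2023 Thm 5.5 (`d ≥ 5`) and the variance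
bounds, through moment generating functions and linearity (the argument printed after ADC
Prop. 1.4 and after Panis Thm 1.2). [cite: AizenmanDuminilCopinAnnals2021, arXiv:1912.07973 Prop. 1.4 and p. 6] -/
theorem isGaussianProcess_of_tendstoInDistribution_smearedSpin_printRegime_of_bounds
    (h₁ : aizenmanDuminilCopin_mgf_normalizedField_bound)
    (h₂ : normalizedField_variance_bounds)
    (h₃ : panis_mgf_normalizedField_bound) :
    isGaussianProcess_of_tendstoInDistribution_smearedSpin_printRegime := by
  intro d hd β δ ρ hβ hδ hρ h4 h5 μ hμ Ω _ P _ Φ hM2 hCV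
  obtain ⟨f₀, hf₀0, hf₀ne⟩ := exists_testFn_nonneg_ne_zero d
  obtain ⟨C₀, hC₀⟩ := hM2 f₀
  have hδpos : ∀ᶠ k in atTop, 0 < δ k := hδ.eventually (eventually_mem_nhdsWithin)
  have hprob : ∀ k, IsProbabilityMeasure (μ k : Measure (SpinConfig (Site d))) :=
    fun k => inferInstance
  -- the window constant `M ≥ 1` (only relevant for `d = 4`)
  obtain ⟨M, hM1, h4'⟩ : ∃ M : ℝ, 1 ≤ M ∧ (d = 4 → ∀ᶠ k in atTop, β k = criticalBeta 4 ∨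
      (0 < β k ∧ invCorrLength (twoPointPlus 4 (β k)) ≤ M * δ k)) := by
    by_cases hd4 : d = 4
    · obtain ⟨M, hM⟩ := h4 hd4
      refine ⟨max M 1, le_max_right _ _, fun _ => ?_⟩
      filter_upwards [hM, hδpos] with k hk hδk
      rcases hk with h | ⟨hβk, hle⟩
      · exact Or.inl h
      · exact Or.inr ⟨hβk, hle.trans (mul_le_mul_of_nonneg_right (le_max_left _ _) hδk.le)⟩
    · exact ⟨1, le_rfl, fun h => absurd h hd4⟩
  -- Step A: every one-dimensional marginal `Φ g` is a centred Gaussian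
  have h1d : ∀ g : TestFn d, ∃ v : ℝ≥0, P.map (Φ g) = gaussianReal 0 v := by
    intro g
    obtain ⟨Cg, hCg⟩ := hM2 g
    obtain ⟨r, hr1, hgr⟩ := exists_cube_of_hasCompactSupport g g.hasCompactSupport
    have hcv := hCV g
    have hX : ∀ k, AEMeasurable (fun σ => smearedSpin (ρ k) (δ k) g σ)
        (μ k : Measure (SpinConfig (Site d))) := hcv.forall_aemeasurable
    have hΦg : AEMeasurable (Φ g) P := hcv.aemeasurable_limit
    haveI : IsProbabilityMeasure (P.map (Φ g)) := Measure.isProbabilityMeasure_map hΦg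
    -- the exponential moments `M_k(z)`
    have hcore : ∀ z : ℝ, Tendsto (fun k =>
        (∫ σ, Real.exp (z * smearedSpin (ρ k) (δ k) g σ) ∂(μ k : Measure (SpinConfig (Site d)))) *
          Real.exp (-(z ^ 2 * (∫ σ, smearedSpin (ρ k) (δ k) g σ ^ 2
            ∂(μ k : Measure (SpinConfig (Site d)))) / 2)) - 1) atTop (𝓝 0) := fun z =>
      tendsto_mgf_mul_exp_sub_one_of_window h₁ h₂ h₃ hd hβ hδ hM1 h4' h5
        (μ := fun k => (μ k : Measure (SpinConfig (Site d)))) hμ g.continuous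
        g.hasCompactSupport hCg f₀.continuous f₀.hasCompactSupport hf₀0 hf₀ne hC₀ z
    -- uniform bound on `M_k(z)`: eventually `M_k(z) ≤ 2 exp(z² Cg/2)`
    have hbound : ∀ z : ℝ, ∀ᶠ k in atTop,
        (∫ σ, Real.exp (z * smearedSpin (ρ k) (δ k) g σ) ∂(μ k : Measure (SpinConfig (Site d))))
          ≤ 2 * Real.exp (z ^ 2 * Cg / 2) := by
      intro z
      have h := (hcore z)
      have h2 : ∀ᶠ k in atTop, (∫ σ, Real.exp (z * smearedSpin (ρ k) (δ k) g σ)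
          ∂(μ k : Measure (SpinConfig (Site d)))) *
            Real.exp (-(z ^ 2 * (∫ σ, smearedSpin (ρ k) (δ k) g σ ^ 2
              ∂(μ k : Measure (SpinConfig (Site d)))) / 2)) - 1 < 1 :=
        h.eventually (gt_mem_nhds one_pos)
      filter_upwards [h2] with k hk
      set V := ∫ σ, smearedSpin (ρ k) (δ k) g σ ^ 2 ∂(μ k : Measure (SpinConfig (Site d)))
      have hVle : V ≤ Cg := hCg k
      have hlt : (∫ σ, Real.exp (z * smearedSpin (ρ k) (δ k) g σ)
          ∂(μ k : Measure (SpinConfig (Site d)))) * Real.exp (-(z ^ 2 * V / 2)) < 2 := by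
        linarith
      rw [Real.exp_neg, ← div_eq_mul_inv, div_lt_iff₀ (Real.exp_pos _)] at hlt
      refine hlt.le.trans ?_
      gcongr
    -- laws and weak convergence
    let ν : ℕ → ProbabilityMeasure ℝ := fun k =>
      ⟨(μ k : Measure (SpinConfig (Site d))).map (fun σ => smearedSpin (ρ k) (δ k) g σ),
        Measure.isProbabilityMeasure_map (hX k)⟩
    let ν₀ : ProbabilityMeasure ℝ := ⟨P.map (Φ g), Measure.isProbabilityMeasure_map hΦg⟩
    have hν : Tendsto ν atTop (𝓝 ν₀) := hcv.tendsto
    -- convergence of `M_k(z)` to the (finite) exponential moment of the limit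
    have hlimit : ∀ z : ℝ, Integrable (fun x => Real.exp (z * x)) (P.map (Φ g)) ∧
        Tendsto (fun k => ∫ σ, Real.exp (z * smearedSpin (ρ k) (δ k) g σ)
          ∂(μ k : Measure (SpinConfig (Site d)))) atTop
          (𝓝 (∫ x, Real.exp (z * x) ∂(P.map (Φ g)))) := by
      intro z
      have hsq : ∀ x : ℝ, Real.exp (z * x) ^ 2 = Real.exp (2 * z * x) := fun x => by
        rw [sq, ← Real.exp_add]
        ring_nf
      have hB : ∀ᶠ k in atTop, Integrable (fun x => Real.exp (z * x) ^ 2) (ν k : Measure ℝ) ∧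
          ∫ x, Real.exp (z * x) ^ 2 ∂(ν k : Measure ℝ) ≤ 2 * Real.exp ((2 * z) ^ 2 * Cg / 2) := by
        filter_upwards [hbound (2 * z), hδpos] with k hk hδk
        have hmap : ∀ (F : ℝ → ℝ), Continuous F →
            ∫ x, F x ∂(ν k : Measure ℝ) = ∫ σ, F (smearedSpin (ρ k) (δ k) g σ)
              ∂(μ k : Measure (SpinConfig (Site d))) := fun F hF => by
          simp only [ν, ProbabilityMeasure.coe_mk]
          exact integral_map (hX k) hF.aestronglyMeasurable
        simp_rw [hsq]
        refine ⟨?_, ?_⟩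
        · simp only [ν, ProbabilityMeasure.coe_mk]
          refine (integrable_map_measure (by fun_prop) (hX k)).mpr ?_
          exact integrable_exp_mul_smearedSpin _ (ρ k) hδk.ne' hgr (2 * z)
        · rw [hmap _ (by fun_prop)]
          exact hk
      have h := tendsto_integral_of_tendsto_of_sq_le hν (by fun_prop)
        (fun x => (Real.exp_pos _).le) hB
      have hmap0 : ∀ k, ∫ x, Real.exp (z * x) ∂(ν k : Measure ℝ) =
          ∫ σ, Real.exp (z * smearedSpin (ρ k) (δ k) g σ)
            ∂(μ k : Measure (SpinConfig (Site d))) := fun k => by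
        simp only [ν, ProbabilityMeasure.coe_mk]
        exact integral_map (hX k) (by fun_prop)
      refine ⟨h.1, ?_⟩
      have h2 := h.2
      simp_rw [hmap0] at h2
      exact h2
    -- identification of the limit
    obtain ⟨v, hv0, hv⟩ := exists_variance_of_tendsto_mgf
      (Mlim := fun z => ∫ x, Real.exp (z * x) ∂(P.map (Φ g)))
      (Eventually.of_forall fun k => integral_nonneg fun σ => sq_nonneg _)
      hcore (fun z => (hlimit z).2)
    exact ⟨v.toNNReal, eq_gaussianReal_of_mgf_eq hv0 (fun z => (hlimit z).1) hv⟩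
  -- Step B: linearity of `Φ` upgrades this to all finite-dimensional marginals
  refine ⟨fun I => ⟨isGaussian_of_map_eq_gaussianReal fun L => ?_⟩⟩
  have hmeas : AEMeasurable (fun ω => I.restrict fun f => Φ f ω) P :=
    aemeasurable_pi_lambda _ fun f => (hCV f).aemeasurable_limit
  rw [AEMeasurable.map_map_of_aemeasurable (by fun_prop) hmeas]
  classical
  let g : TestFn d := ∑ i : I, (L fun j => if i = j then (1 : ℝ) else 0) • (i : TestFn d)
  have hcomp : ((L : (I → ℝ) → ℝ) ∘ fun ω => I.restrict fun f => Φ f ω) = Φ g := by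
    funext ω
    rw [Function.comp_apply, ← ContinuousLinearMap.coe_coe,
      LinearMap.pi_apply_eq_sum_univ (L : (I → ℝ) →ₗ[ℝ] ℝ)]
    simp only [g, map_sum, map_smul, Finset.sum_apply, Pi.smul_apply, smul_eq_mul,
      ContinuousLinearMap.coe_coe, Finset.restrict]
    exact Finset.sum_congr rfl fun i _ => mul_comm _ _
  obtain ⟨v, hv⟩ := h1d g
  exact ⟨0, v, by rw [hcomp, hv]⟩

end Literature.Probability.LatticeModels
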